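import Literature.MathematicalPhysics.QuantumLattice.PairedProductStates
import Literature.MathematicalPhysics.QuantumLattice.FreeFermiGasNoPairFieldLRO
import Literature.MathematicalPhysics.QuantumLattice.ApproximateEigenvectorLemmas

/-!
# Route `JosephsonMirror` — pair-operator bounds in momentum space (free layers)

Helper file for support item stmt-HubbardSuperconductivity-2232 (`JmFreeLayersNoCusp`) of route
`JosephsonMirror` (sub-problem `HubbardSuperconductivity`). Elementary quadratic-form estimates for
the momentum pair modes `b_k = c_{-k↓} c_{k↑}` (`pairMode`) and pair operators
`B(ĝ, S) = Σ_{k ∈ S} ĝ(k) b_k` (`pairOperator`) on the fermionic torus `(ℤ/Lℤ)²`, all in the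
form `Re ⟨w, · w⟩` for an arbitrary Fock vector `w`:

* weighted Cauchy–Schwarz for finite sums of vectors
  (`re_star_dotProduct_sum_smul_self_le`: `‖Σ c_k u_k‖² ≤ (Σ |c_k|²/w_k)(Σ w_k ‖u_k‖²)`);
* one-mode bounds from the CAR: `0 ≤ n_{kσ} ≤ 1`, `‖b_k w‖² ≤ ⟨w, n_{k↑} w⟩`,
  `‖b_k† w‖² ≤ ⟨w, (1 - n_{-k↓}) w⟩`;
* the commutator sum `B Bᴴ - Bᴴ B = Σ_{k∈S} ĝ(k)² (1 - n_{k↑} - n_{-k↓})`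
  (`pairMode_commutator_conjTranspose`) as a quadratic form;
* the three regional bounds used by the `U = 0` calibration: outside the Fermi sea
  (`ξ_k ≥ Λ`: `‖B_S w‖² ≤ (4|S|/Λ) Σ_S ξ_k ⟨n_{k↑}⟩`), inside (`ξ_k ≤ -Λ`:
  `‖B_Sᴴ w‖² ≤ (4|S|/Λ) Σ_S |ξ_k| ⟨1 - n_{-k↓}⟩`) and on a shell (`‖B_S w‖², ‖B_Sᴴ w‖² ≤ 4|S|²‖w‖²`),
  for form factors `|ĝ| ≤ 2`.

Sources: J. Bardeen, L. N. Cooper, J. R. Schrieffer, Phys. Rev. 108 (1957) 1175, §II (pair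
operators, kinetic-energy cost of pair fluctuations); J. von Delft, D. C. Ralph, Phys. Rep. 345
(2001) 61, §4.2.3 (hard-core boson algebra). Folklore finite-dimensional statements; no new
definitions.
-/

-- the mandated namespace `Summit.<Summit>.<Problem>.Theorems` repeats `HubbardSuperconductivity`
-- (single-problem summit, D-0017), which the `dupNamespace` linter flags on every declaration
set_option linter.dupNamespace false

namespace Summit.HubbardSuperconductivity.HubbardSuperconductivity.Theorems.JosephsonMirror

open Matrix Finset Literature.MathematicalPhysics.QuantumLattice Literature.Probability.LatticeModels
open scoped ComplexOrder ComplexConjugate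

/-! ### Weighted Cauchy–Schwarz for finite sums of vectors -/

section Norms

variable {n : Type*} [Fintype n]

/-- `‖v‖² = Re ⟨v, v⟩ ≥ 0`. [folklore] -/
theorem re_star_dotProduct_self_nonneg' (v : n → ℂ) : 0 ≤ (star v ⬝ᵥ v).re :=
  (Complex.nonneg_iff.1 (dotProduct_star_self_nonneg v)).1

/-- Triangle inequality for a weighted finite sum: `‖Σ_k c_k u_k‖₂ ≤ Σ_k |c_k| ‖u_k‖₂`.
[folklore] -/
theorem eucNorm_sum_smul_le {α : Type*} (S : Finset α) (c : α → ℂ) (u : α → n → ℂ) :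
    eucNorm (∑ k ∈ S, c k • u k) ≤ ∑ k ∈ S, ‖c k‖ * eucNorm (u k) := by
  classical
  induction S using Finset.induction_on with
  | empty => simp
  | @insert k S hk ih =>
    rw [Finset.sum_insert hk, Finset.sum_insert hk]
    calc eucNorm (c k • u k + ∑ j ∈ S, c j • u j)
        ≤ eucNorm (c k • u k) + eucNorm (∑ j ∈ S, c j • u j) := eucNorm_add_le _ _
      _ ≤ ‖c k‖ * eucNorm (u k) + ∑ j ∈ S, ‖c j‖ * eucNorm (u j) := by
          rw [eucNorm_smul]; linarith

/-- **Weighted Cauchy–Schwarz**: for positive weights `w_k`,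
`‖Σ_k c_k u_k‖² ≤ (Σ_k |c_k|² / w_k) · (Σ_k w_k ‖u_k‖²)`. [folklore] -/
theorem re_star_dotProduct_sum_smul_self_le {α : Type*} (S : Finset α) (c : α → ℂ)
    (u : α → n → ℂ) {w : α → ℝ} (hw : ∀ k ∈ S, 0 < w k) :
    (star (∑ k ∈ S, c k • u k) ⬝ᵥ (∑ k ∈ S, c k • u k)).re ≤
      (∑ k ∈ S, ‖c k‖ ^ 2 / w k) * ∑ k ∈ S, w k * (star (u k) ⬝ᵥ u k).re := by
  have h1 := eucNorm_sum_smul_le S c u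
  have h2 : (∑ k ∈ S, ‖c k‖ * eucNorm (u k)) ^ 2 ≤
      (∑ k ∈ S, ‖c k‖ ^ 2 / w k) * ∑ k ∈ S, w k * eucNorm (u k) ^ 2 :=
    Finset.sum_sq_le_sum_mul_sum_of_sq_le_mul S
      (fun k hk => div_nonneg (sq_nonneg _) (hw k hk).le)
      (fun k hk => mul_nonneg (hw k hk).le (sq_nonneg _))
      (fun k hk => le_of_eq (by
        rw [mul_pow, div_mul_eq_mul_div, eq_div_iff (hw k hk).ne']
        ring))
  have h3 : ∑ k ∈ S, w k * eucNorm (u k) ^ 2 = ∑ k ∈ S, w k * (star (u k) ⬝ᵥ u k).re :=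
    Finset.sum_congr rfl fun k _ => by rw [eucNorm_sq]
  calc (star (∑ k ∈ S, c k • u k) ⬝ᵥ (∑ k ∈ S, c k • u k)).re
      = eucNorm (∑ k ∈ S, c k • u k) ^ 2 := (eucNorm_sq _).symm
    _ ≤ (∑ k ∈ S, ‖c k‖ * eucNorm (u k)) ^ 2 := pow_le_pow_left₀ (eucNorm_nonneg _) h1 2
    _ ≤ (∑ k ∈ S, ‖c k‖ ^ 2 / w k) * ∑ k ∈ S, w k * eucNorm (u k) ^ 2 := h2
    _ = _ := by rw [h3]

/-- `‖a + b + c‖² ≤ 3 (‖a‖² + ‖b‖² + ‖c‖²)`. [folklore] -/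
theorem re_star_dotProduct_add_three_self_le (a b c : n → ℂ) :
    (star (a + b + c) ⬝ᵥ (a + b + c)).re ≤
      3 * ((star a ⬝ᵥ a).re + (star b ⬝ᵥ b).re + (star c ⬝ᵥ c).re) := by
  rw [← eucNorm_sq, ← eucNorm_sq, ← eucNorm_sq, ← eucNorm_sq]
  have h : eucNorm (a + b + c) ≤ eucNorm a + eucNorm b + eucNorm c :=
    (eucNorm_add_le _ _).trans (by linarith [eucNorm_add_le a b])
  have ha := eucNorm_nonneg a
  have hb := eucNorm_nonneg b
  have hc := eucNorm_nonneg c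
  have h2 : eucNorm (a + b + c) ^ 2 ≤ (eucNorm a + eucNorm b + eucNorm c) ^ 2 :=
    pow_le_pow_left₀ (eucNorm_nonneg _) h 2
  nlinarith [sq_nonneg (eucNorm a - eucNorm b), sq_nonneg (eucNorm b - eucNorm c),
    sq_nonneg (eucNorm a - eucNorm c)]

end Norms

/-! ### One-mode bounds from the CAR -/

section Modes

variable {L : ℕ} [NeZero L]

/-- `Re ⟨w, n_{kσ} w⟩ = ‖c_{kσ} w‖²`. [folklore] -/
theorem re_expect_momentumNumber_eq (k : TorusSite 2 L) (σ : Fin 2)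
    (w : Fock (Orb (FermionTorus 2 L))) :
    (star w ⬝ᵥ momentumNumber k σ *ᵥ w).re =
      (star (momentumAnnihilation k σ *ᵥ w) ⬝ᵥ (momentumAnnihilation k σ *ᵥ w)).re := by
  rw [momentumNumber, momentumCreation, ← mulVec_mulVec, dotProduct_mulVec, ← star_mulVec]

/-- `0 ≤ Re ⟨w, n_{kσ} w⟩`. [folklore] -/
theorem re_expect_momentumNumber_nonneg (k : TorusSite 2 L) (σ : Fin 2)
    (w : Fock (Orb (FermionTorus 2 L))) : 0 ≤ (star w ⬝ᵥ momentumNumber k σ *ᵥ w).re := by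
  rw [re_expect_momentumNumber_eq]
  exact re_star_dotProduct_self_nonneg' _

/-- `Re ⟨w, w⟩ - Re ⟨w, n_{kσ} w⟩ = ‖c†_{kσ} w‖²` (`c c† = 1 - c† c`). [folklore] -/
theorem re_expect_one_sub_momentumNumber_eq (k : TorusSite 2 L) (σ : Fin 2)
    (w : Fock (Orb (FermionTorus 2 L))) :
    (star w ⬝ᵥ w).re - (star w ⬝ᵥ momentumNumber k σ *ᵥ w).re =
      (star (momentumCreation k σ *ᵥ w) ⬝ᵥ (momentumCreation k σ *ᵥ w)).re := by
  have h : momentumAnnihilation k σ * momentumCreation k σ = 1 - momentumNumber k σ := by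
    rw [momentumAnnihilation_mul_momentumCreation, if_pos ⟨rfl, rfl⟩, momentumNumber]
  rw [star_mulVec, ← dotProduct_mulVec, mulVec_mulVec, momentumCreation_conjTranspose, h,
    sub_mulVec, one_mulVec, dotProduct_sub, Complex.sub_re]

/-- `Re ⟨w, n_{kσ} w⟩ ≤ Re ⟨w, w⟩` (`n_{kσ} ≤ 1`). [folklore] -/
theorem re_expect_momentumNumber_le (k : TorusSite 2 L) (σ : Fin 2)
    (w : Fock (Orb (FermionTorus 2 L))) :
    (star w ⬝ᵥ momentumNumber k σ *ᵥ w).re ≤ (star w ⬝ᵥ w).re := by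
  have h := re_expect_one_sub_momentumNumber_eq k σ w
  have h0 := re_star_dotProduct_self_nonneg' (momentumCreation k σ *ᵥ w)
  linarith

/-- `‖c_{kσ} u‖² ≤ ‖u‖²`. [folklore] -/
theorem re_norm_momentumAnnihilation_mulVec_le (k : TorusSite 2 L) (σ : Fin 2)
    (u : Fock (Orb (FermionTorus 2 L))) :
    (star (momentumAnnihilation k σ *ᵥ u) ⬝ᵥ (momentumAnnihilation k σ *ᵥ u)).re ≤
      (star u ⬝ᵥ u).re := by
  rw [← re_expect_momentumNumber_eq]
  exact re_expect_momentumNumber_le k σ u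

/-- `‖c†_{kσ} u‖² ≤ ‖u‖²`. [folklore] -/
theorem re_norm_momentumCreation_mulVec_le (k : TorusSite 2 L) (σ : Fin 2)
    (u : Fock (Orb (FermionTorus 2 L))) :
    (star (momentumCreation k σ *ᵥ u) ⬝ᵥ (momentumCreation k σ *ᵥ u)).re ≤
      (star u ⬝ᵥ u).re := by
  rw [← re_expect_one_sub_momentumNumber_eq]
  linarith [re_expect_momentumNumber_nonneg k σ u]

/-- `‖b_k w‖² ≤ Re ⟨w, n_{k↑} w⟩` (`b_k = c_{-k↓} c_{k↑}` and `‖c_{-k↓} ·‖ ≤ ‖·‖`). [folklore] -/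
theorem re_norm_pairMode_mulVec_le (k : TorusSite 2 L) (w : Fock (Orb (FermionTorus 2 L))) :
    (star (pairMode k *ᵥ w) ⬝ᵥ (pairMode k *ᵥ w)).re ≤
      (star w ⬝ᵥ momentumNumber k 0 *ᵥ w).re := by
  rw [pairMode, ← mulVec_mulVec, re_expect_momentumNumber_eq]
  exact re_norm_momentumAnnihilation_mulVec_le (-k) 1 _

/-- `‖b_k† w‖² ≤ Re ⟨w, w⟩ - Re ⟨w, n_{-k↓} w⟩` (`b_k† = c†_{k↑} c†_{-k↓}` and `‖c†_{k↑} ·‖ ≤ ‖·‖`).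
[folklore] -/
theorem re_norm_pairMode_conjTranspose_mulVec_le (k : TorusSite 2 L)
    (w : Fock (Orb (FermionTorus 2 L))) :
    (star ((pairMode k)ᴴ *ᵥ w) ⬝ᵥ ((pairMode k)ᴴ *ᵥ w)).re ≤
      (star w ⬝ᵥ w).re - (star w ⬝ᵥ momentumNumber (-k) 1 *ᵥ w).re := by
  rw [pairMode_conjTranspose, ← mulVec_mulVec, re_expect_one_sub_momentumNumber_eq]
  exact re_norm_momentumCreation_mulVec_le k 0 _

/-- `‖b_k† w‖² ≤ ‖w‖²`. [folklore] -/
theorem re_norm_pairMode_conjTranspose_mulVec_le_self (k : TorusSite 2 L)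
    (w : Fock (Orb (FermionTorus 2 L))) :
    (star ((pairMode k)ᴴ *ᵥ w) ⬝ᵥ ((pairMode k)ᴴ *ᵥ w)).re ≤ (star w ⬝ᵥ w).re := by
  have h := re_norm_pairMode_conjTranspose_mulVec_le k w
  linarith [re_expect_momentumNumber_nonneg (-k) 1 w]

end Modes

/-! ### Pair operators: the commutator sum and the three regional bounds -/

section PairOperator

variable {L : ℕ} [NeZero L]

/-- `B(ĝ,S) w = Σ_{k∈S} ĝ(k) (b_k w)`. [folklore] -/
theorem pairOperator_mulVec (ĝ : TorusSite 2 L → ℝ) (S : Finset (TorusSite 2 L))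
    (w : Fock (Orb (FermionTorus 2 L))) :
    pairOperator ĝ S *ᵥ w = ∑ k ∈ S, (ĝ k : ℂ) • (pairMode k *ᵥ w) := by
  rw [pairOperator, sum_mulVec]
  exact Finset.sum_congr rfl fun k _ => smul_mulVec _ _ _

/-- `B(ĝ,S)ᴴ = Σ_{k∈S} ĝ(k) b_k†` (`ĝ` real). [folklore] -/
theorem pairOperator_conjTranspose_eq_sum (ĝ : TorusSite 2 L → ℝ) (S : Finset (TorusSite 2 L)) :
    (pairOperator ĝ S)ᴴ = ∑ k ∈ S, (ĝ k : ℂ) • (pairMode k)ᴴ := by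
  simp only [pairOperator, conjTranspose_sum, conjTranspose_smul, Complex.star_def,
    Complex.conj_ofReal]

/-- `B(ĝ,S)ᴴ w = Σ_{k∈S} ĝ(k) (b_k† w)`. [folklore] -/
theorem pairOperator_conjTranspose_mulVec (ĝ : TorusSite 2 L → ℝ) (S : Finset (TorusSite 2 L))
    (w : Fock (Orb (FermionTorus 2 L))) :
    (pairOperator ĝ S)ᴴ *ᵥ w = ∑ k ∈ S, (ĝ k : ℂ) • ((pairMode k)ᴴ *ᵥ w) := by
  rw [pairOperator_conjTranspose_eq_sum, sum_mulVec]
  exact Finset.sum_congr rfl fun k _ => smul_mulVec _ _ _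

/-- **The commutator sum** `B Bᴴ - Bᴴ B = Σ_{k∈S} ĝ(k)² (1 - n_{k↑} - n_{-k↓})` for
`B = B(ĝ, S)` (`[b_k, b_j†] = δ_{kj}(1 - n_{k↑} - n_{-k↓})`). von Delft–Ralph (2001) §4.2.3.
[folklore] -/
theorem pairOperator_mul_conjTranspose_sub (ĝ : TorusSite 2 L → ℝ) (S : Finset (TorusSite 2 L)) :
    pairOperator ĝ S * (pairOperator ĝ S)ᴴ - (pairOperator ĝ S)ᴴ * pairOperator ĝ S =
      ∑ k ∈ S, ((ĝ k) ^ 2 : ℂ) • (1 - momentumNumber k 0 - momentumNumber (-k) 1) := by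
  rw [pairOperator_conjTranspose_eq_sum, pairOperator, Finset.sum_mul_sum, Finset.sum_mul_sum,
    Finset.sum_comm (s := S) (t := S) (f := fun j k => ((ĝ j : ℂ) • (pairMode j)ᴴ) * _),
    ← Finset.sum_sub_distrib]
  refine Finset.sum_congr rfl fun k hk => ?_
  rw [← Finset.sum_sub_distrib]
  have h : ∀ j ∈ S, (ĝ k : ℂ) • pairMode k * ((ĝ j : ℂ) • (pairMode j)ᴴ) -
      (ĝ j : ℂ) • (pairMode j)ᴴ * ((ĝ k : ℂ) • pairMode k) =
      if k = j then ((ĝ k) ^ 2 : ℂ) • (1 - momentumNumber k 0 - momentumNumber (-k) 1) else 0 := by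
    intro j _
    rw [smul_mul_smul_comm, smul_mul_smul_comm, mul_comm (ĝ j : ℂ) (ĝ k : ℂ), ← smul_sub,
      pairMode_commutator_conjTranspose]
    split_ifs with hkj
    · subst hkj; rw [sq]
    · rw [smul_zero]
  rw [Finset.sum_congr rfl h, Finset.sum_ite_eq, if_pos hk]

/-- The commutator sum as quadratic forms:
`‖Bᴴ w‖² = ‖B w‖² + Σ_{k∈S} ĝ(k)² (‖w‖² - ⟨w, n_{k↑} w⟩ - ⟨w, n_{-k↓} w⟩)`. [folklore] -/
theorem re_norm_pairOperator_conjTranspose_mulVec_eq (ĝ : TorusSite 2 L → ℝ)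
    (S : Finset (TorusSite 2 L)) (w : Fock (Orb (FermionTorus 2 L))) :
    (star ((pairOperator ĝ S)ᴴ *ᵥ w) ⬝ᵥ ((pairOperator ĝ S)ᴴ *ᵥ w)).re =
      (star (pairOperator ĝ S *ᵥ w) ⬝ᵥ (pairOperator ĝ S *ᵥ w)).re +
        ∑ k ∈ S, (ĝ k) ^ 2 * ((star w ⬝ᵥ w).re - (star w ⬝ᵥ momentumNumber k 0 *ᵥ w).re -
          (star w ⬝ᵥ momentumNumber (-k) 1 *ᵥ w).re) := by
  have h1 : star ((pairOperator ĝ S)ᴴ *ᵥ w) ⬝ᵥ ((pairOperator ĝ S)ᴴ *ᵥ w) =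
      star w ⬝ᵥ (pairOperator ĝ S * (pairOperator ĝ S)ᴴ) *ᵥ w := by
    rw [star_mulVec, ← dotProduct_mulVec, mulVec_mulVec, conjTranspose_conjTranspose]
  have h2 : star (pairOperator ĝ S *ᵥ w) ⬝ᵥ (pairOperator ĝ S *ᵥ w) =
      star w ⬝ᵥ ((pairOperator ĝ S)ᴴ * pairOperator ĝ S) *ᵥ w := by
    rw [star_mulVec, ← dotProduct_mulVec, mulVec_mulVec]
  have h3 := congrArg (fun M => (star w ⬝ᵥ M *ᵥ w).re) (pairOperator_mul_conjTranspose_sub ĝ S)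
  simp only [sub_mulVec, dotProduct_sub, Complex.sub_re, sum_mulVec, dotProduct_sum,
    Complex.re_sum, smul_mulVec, dotProduct_smul, smul_eq_mul, one_mulVec] at h3
  rw [h1, h2]
  have h4 : ∀ k ∈ S, (((ĝ k) ^ 2 : ℂ) * (star w ⬝ᵥ w - star w ⬝ᵥ momentumNumber k 0 *ᵥ w -
      star w ⬝ᵥ momentumNumber (-k) 1 *ᵥ w)).re =
      (ĝ k) ^ 2 * ((star w ⬝ᵥ w).re - (star w ⬝ᵥ momentumNumber k 0 *ᵥ w).re -
        (star w ⬝ᵥ momentumNumber (-k) 1 *ᵥ w).re) := by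
    intro k _
    rw [← Complex.ofReal_pow, Complex.re_ofReal_mul, Complex.sub_re, Complex.sub_re]
  rw [Finset.sum_congr rfl h4] at h3
  linarith

omit [NeZero L] in
/-- `|ĝ(k)| ≤ 2` gives `‖ĝ(k)‖² ≤ 4` for the complexified form factor. [folklore] -/
theorem norm_sq_ofReal_le_four {ĝ : TorusSite 2 L → ℝ} (hĝ : ∀ k, |ĝ k| ≤ 2) (k : TorusSite 2 L) :
    ‖(ĝ k : ℂ)‖ ^ 2 ≤ 4 := by
  rw [Complex.norm_real, Real.norm_eq_abs]
  nlinarith [hĝ k, abs_nonneg (ĝ k)]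

/-- **Outside the Fermi sea.** If `ξ_k = ε_L(k) - μ ≥ Λ > 0` on `S` and `|ĝ| ≤ 2`, then
`‖B(ĝ,S) w‖² ≤ (4|S|/Λ) Σ_{k∈S} ξ_k Re ⟨w, n_{k↑} w⟩` (weighted Cauchy–Schwarz with weights `ξ_k`
and `‖b_k w‖² ≤ ⟨n_{k↑}⟩`). BCS (1957) §II. [folklore] -/
theorem re_norm_pairOperator_mulVec_le_out {ĝ : TorusSite 2 L → ℝ} (hĝ : ∀ k, |ĝ k| ≤ 2)
    (μ : ℝ) {Λ : ℝ} (hΛ : 0 < Λ) (S : Finset (TorusSite 2 L))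
    (hS : ∀ k ∈ S, Λ ≤ torusBand L k - μ) (w : Fock (Orb (FermionTorus 2 L))) :
    (star (pairOperator ĝ S *ᵥ w) ⬝ᵥ (pairOperator ĝ S *ᵥ w)).re ≤
      4 * S.card / Λ * ∑ k ∈ S, (torusBand L k - μ) * (star w ⬝ᵥ momentumNumber k 0 *ᵥ w).re := by
  have hpos : ∀ k ∈ S, 0 < torusBand L k - μ := fun k hk => hΛ.trans_le (hS k hk)
  rw [pairOperator_mulVec]
  refine (re_star_dotProduct_sum_smul_self_le S _ _ hpos).trans ?_
  have h1 : ∑ k ∈ S, ‖(ĝ k : ℂ)‖ ^ 2 / (torusBand L k - μ) ≤ 4 * S.card / Λ := by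
    calc ∑ k ∈ S, ‖(ĝ k : ℂ)‖ ^ 2 / (torusBand L k - μ) ≤ ∑ _k ∈ S, 4 / Λ :=
          Finset.sum_le_sum fun k hk =>
            div_le_div₀ (by norm_num) (norm_sq_ofReal_le_four hĝ k) hΛ (hS k hk)
      _ = 4 * S.card / Λ := by rw [Finset.sum_const, nsmul_eq_mul]; ring
  have h2 : ∑ k ∈ S, (torusBand L k - μ) *
      (star (pairMode k *ᵥ w) ⬝ᵥ (pairMode k *ᵥ w)).re ≤
      ∑ k ∈ S, (torusBand L k - μ) * (star w ⬝ᵥ momentumNumber k 0 *ᵥ w).re :=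
    Finset.sum_le_sum fun k hk =>
      mul_le_mul_of_nonneg_left (re_norm_pairMode_mulVec_le k w) (hpos k hk).le
  have h3 : 0 ≤ ∑ k ∈ S, (torusBand L k - μ) *
      (star (pairMode k *ᵥ w) ⬝ᵥ (pairMode k *ᵥ w)).re :=
    Finset.sum_nonneg fun k hk => mul_nonneg (hpos k hk).le (re_star_dotProduct_self_nonneg' _)
  have h4 : 0 ≤ 4 * (S.card : ℝ) / Λ := by positivity
  calc (∑ k ∈ S, ‖(ĝ k : ℂ)‖ ^ 2 / (torusBand L k - μ)) *
        ∑ k ∈ S, (torusBand L k - μ) * (star (pairMode k *ᵥ w) ⬝ᵥ (pairMode k *ᵥ w)).re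
      ≤ 4 * S.card / Λ *
        ∑ k ∈ S, (torusBand L k - μ) * (star (pairMode k *ᵥ w) ⬝ᵥ (pairMode k *ᵥ w)).re :=
        mul_le_mul_of_nonneg_right h1 h3
    _ ≤ _ := mul_le_mul_of_nonneg_left h2 h4

/-- **Inside the Fermi sea.** If `ξ_k = ε_L(k) - μ ≤ -Λ < 0` on `S` and `|ĝ| ≤ 2`, then
`‖B(ĝ,S)ᴴ w‖² ≤ (4|S|/Λ) Σ_{k∈S} |ξ_k| (Re ⟨w, w⟩ - Re ⟨w, n_{-k↓} w⟩)` (weights `|ξ_k|`,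
`‖b_k† w‖² ≤ ⟨1 - n_{-k↓}⟩`: pair fluctuations inside the sea cost hole energy). BCS (1957) §II.
[folklore] -/
theorem re_norm_pairOperator_conjTranspose_mulVec_le_in {ĝ : TorusSite 2 L → ℝ}
    (hĝ : ∀ k, |ĝ k| ≤ 2) (μ : ℝ) {Λ : ℝ} (hΛ : 0 < Λ) (S : Finset (TorusSite 2 L))
    (hS : ∀ k ∈ S, torusBand L k - μ ≤ -Λ) (w : Fock (Orb (FermionTorus 2 L))) :
    (star ((pairOperator ĝ S)ᴴ *ᵥ w) ⬝ᵥ ((pairOperator ĝ S)ᴴ *ᵥ w)).re ≤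
      4 * S.card / Λ * ∑ k ∈ S, (μ - torusBand L k) *
        ((star w ⬝ᵥ w).re - (star w ⬝ᵥ momentumNumber (-k) 1 *ᵥ w).re) := by
  have hpos : ∀ k ∈ S, 0 < μ - torusBand L k := fun k hk => by linarith [hS k hk]
  rw [pairOperator_conjTranspose_mulVec]
  refine (re_star_dotProduct_sum_smul_self_le S _ _ hpos).trans ?_
  have h1 : ∑ k ∈ S, ‖(ĝ k : ℂ)‖ ^ 2 / (μ - torusBand L k) ≤ 4 * S.card / Λ := by
    calc ∑ k ∈ S, ‖(ĝ k : ℂ)‖ ^ 2 / (μ - torusBand L k) ≤ ∑ _k ∈ S, 4 / Λ :=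
          Finset.sum_le_sum fun k hk =>
            div_le_div₀ (by norm_num) (norm_sq_ofReal_le_four hĝ k) hΛ (by linarith [hS k hk])
      _ = 4 * S.card / Λ := by rw [Finset.sum_const, nsmul_eq_mul]; ring
  have h2 : ∑ k ∈ S, (μ - torusBand L k) *
      (star ((pairMode k)ᴴ *ᵥ w) ⬝ᵥ ((pairMode k)ᴴ *ᵥ w)).re ≤
      ∑ k ∈ S, (μ - torusBand L k) *
        ((star w ⬝ᵥ w).re - (star w ⬝ᵥ momentumNumber (-k) 1 *ᵥ w).re) :=
    Finset.sum_le_sum fun k hk =>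
      mul_le_mul_of_nonneg_left (re_norm_pairMode_conjTranspose_mulVec_le k w) (hpos k hk).le
  have h3 : 0 ≤ ∑ k ∈ S, (μ - torusBand L k) *
      (star ((pairMode k)ᴴ *ᵥ w) ⬝ᵥ ((pairMode k)ᴴ *ᵥ w)).re :=
    Finset.sum_nonneg fun k hk => mul_nonneg (hpos k hk).le (re_star_dotProduct_self_nonneg' _)
  have h4 : 0 ≤ 4 * (S.card : ℝ) / Λ := by positivity
  calc (∑ k ∈ S, ‖(ĝ k : ℂ)‖ ^ 2 / (μ - torusBand L k)) *
        ∑ k ∈ S, (μ - torusBand L k) *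
          (star ((pairMode k)ᴴ *ᵥ w) ⬝ᵥ ((pairMode k)ᴴ *ᵥ w)).re
      ≤ 4 * S.card / Λ * ∑ k ∈ S, (μ - torusBand L k) *
          (star ((pairMode k)ᴴ *ᵥ w) ⬝ᵥ ((pairMode k)ᴴ *ᵥ w)).re :=
        mul_le_mul_of_nonneg_right h1 h3
    _ ≤ _ := mul_le_mul_of_nonneg_left h2 h4

/-- **On a shell** (crude, coherent bound): `‖B(ĝ,S)ᴴ w‖² ≤ 4 |S|² ‖w‖²` for `|ĝ| ≤ 2`
(Cauchy–Schwarz with unit weights and `‖b_k† w‖ ≤ ‖w‖`). [folklore] -/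
theorem re_norm_pairOperator_conjTranspose_mulVec_le_shell {ĝ : TorusSite 2 L → ℝ}
    (hĝ : ∀ k, |ĝ k| ≤ 2) (S : Finset (TorusSite 2 L)) (w : Fock (Orb (FermionTorus 2 L))) :
    (star ((pairOperator ĝ S)ᴴ *ᵥ w) ⬝ᵥ ((pairOperator ĝ S)ᴴ *ᵥ w)).re ≤
      4 * (S.card : ℝ) ^ 2 * (star w ⬝ᵥ w).re := by
  rw [pairOperator_conjTranspose_mulVec]
  refine (re_star_dotProduct_sum_smul_self_le S _ _ (w := fun _ => (1 : ℝ))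
    (fun _ _ => one_pos)).trans ?_
  have h1 : ∑ k ∈ S, ‖(ĝ k : ℂ)‖ ^ 2 / (1 : ℝ) ≤ 4 * S.card := by
    calc ∑ k ∈ S, ‖(ĝ k : ℂ)‖ ^ 2 / (1 : ℝ) ≤ ∑ _k ∈ S, (4 : ℝ) :=
          Finset.sum_le_sum fun k _ => by rw [div_one]; exact norm_sq_ofReal_le_four hĝ k
      _ = 4 * S.card := by rw [Finset.sum_const, nsmul_eq_mul]; ring
  have h2 : ∑ k ∈ S, (1 : ℝ) * (star ((pairMode k)ᴴ *ᵥ w) ⬝ᵥ ((pairMode k)ᴴ *ᵥ w)).re ≤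
      S.card * (star w ⬝ᵥ w).re := by
    calc ∑ k ∈ S, (1 : ℝ) * (star ((pairMode k)ᴴ *ᵥ w) ⬝ᵥ ((pairMode k)ᴴ *ᵥ w)).re
        ≤ ∑ _k ∈ S, (star w ⬝ᵥ w).re := Finset.sum_le_sum fun k _ => by
            rw [one_mul]; exact re_norm_pairMode_conjTranspose_mulVec_le_self k w
      _ = S.card * (star w ⬝ᵥ w).re := by rw [Finset.sum_const, nsmul_eq_mul]
  have h3 : 0 ≤ ∑ k ∈ S, (1 : ℝ) * (star ((pairMode k)ᴴ *ᵥ w) ⬝ᵥ ((pairMode k)ᴴ *ᵥ w)).re :=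
    Finset.sum_nonneg fun k _ => by rw [one_mul]; exact re_star_dotProduct_self_nonneg' _
  have h4 : 0 ≤ 4 * (S.card : ℝ) := by positivity
  calc (∑ k ∈ S, ‖(ĝ k : ℂ)‖ ^ 2 / (1 : ℝ)) *
        ∑ k ∈ S, (1 : ℝ) * (star ((pairMode k)ᴴ *ᵥ w) ⬝ᵥ ((pairMode k)ᴴ *ᵥ w)).re
      ≤ 4 * S.card * ∑ k ∈ S, (1 : ℝ) *
          (star ((pairMode k)ᴴ *ᵥ w) ⬝ᵥ ((pairMode k)ᴴ *ᵥ w)).re :=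
        mul_le_mul_of_nonneg_right h1 h3
    _ ≤ 4 * S.card * (S.card * (star w ⬝ᵥ w).re) := mul_le_mul_of_nonneg_left h2 h4
    _ = _ := by ring

end PairOperator

end Summit.HubbardSuperconductivity.HubbardSuperconductivity.Theorems.JosephsonMirror
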